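import Mathlib
import HarnessLib

/-!
# The primitive `gPrim` and the modulus profile of a vertical line (P15 kernel, brick E5-1)

HONEST FRAMING: systematic search; no irrationality claim unless certified.  This file is pure
real calculus: no statement about `ζ(2)`, `ζ(5)` or any linear form is made here.

For `η w : ℝ` put `halfLog η w = log (w² + η²) / 2` (`= log ‖w + iη‖`, `log_norm_eq_halfLog`) and
`gPrim η w = w · log (w² + η²) / 2 − w + η · arctan (w / η)`.  For `η ≠ 0`, `gPrim η` is a primitive
of `halfLog η` (`hasDerivAt_gPrim`) and its `η`-derivative is the angle `arctan (w / η)`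
(`hasDerivAt_gPrim_eta`).  From the mean value theorem we get the unit-step comparisons between
sums of `halfLog` over arithmetic progressions and differences of `gPrim`
(`sum_Ico_halfLog_le`, `le_sum_Ico_halfLog`, `sum_Ico_halfLog_le_of_nonpos`, and the straddling
version `sum_Ico_halfLog_le_straddle` with the additive constant `1 + log 2`), the scaling law
`gPrim_scale`, and we define the line profile of the two-tale P15 rational function
(cell record `families/denom/P15KERNEL.md` §6, §8):
`profile ξ η = profile0 ξ η − 2π|η|`, where `profile0` collects the four blocks
`(ξ+2 | ξ−11)`, `(ξ | ξ−9)`, `(ξ−2 | ξ−7)` (numerator) and `(ξ+15 | ξ+4)` (denominator) and the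
factorial constant `profileConst = 11 log 11 − 13 log 13 − 9 log 9 − 5 log 5 + 16`; its
`η`-derivative is `angle ξ η` (`hasDerivAt_profile0_eta`, `hasDerivAt_profile_eta`).
These are the inputs of the pointwise modulus bound (brick E5-2) and of the two-point tangent
certificate (brick E5-4) of `P15KERNEL.md` §8.
-/

noncomputable section

open Real Set

namespace Summit.KontsevichZagierPeriods.Zeta5Search.Denom.LineProfile

variable {η : ℝ}

/-! ## The integrand `halfLog` and its primitive `gPrim` -/

/-- `halfLog η w = log (w² + η²) / 2`, the logarithm of the modulus `‖w + iη‖`. -/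
def halfLog (η w : ℝ) : ℝ := Real.log (w ^ 2 + η ^ 2) / 2

/-- The primitive `gPrim η w = w · log (w² + η²) / 2 − w + η · arctan (w / η)` of `halfLog η`. -/
def gPrim (η w : ℝ) : ℝ := w * Real.log (w ^ 2 + η ^ 2) / 2 - w + η * Real.arctan (w / η)

/-- `log ‖w + iη‖ = halfLog η w` (also in the junk case `w = η = 0`, where both sides vanish). -/
theorem log_norm_eq_halfLog (w η : ℝ) :
    Real.log ‖(w : ℂ) + η * Complex.I‖ = halfLog η w := by
  rw [Complex.norm_add_mul_I, Real.log_sqrt (by positivity), halfLog]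

/-- `halfLog` is even in `w`. -/
theorem halfLog_neg (η w : ℝ) : halfLog η (-w) = halfLog η w := by
  simp [halfLog]

/-- `gPrim` is odd in `w`. -/
theorem gPrim_neg (η w : ℝ) : gPrim η (-w) = -gPrim η w := by
  simp only [gPrim, neg_sq, neg_div, Real.arctan_neg]
  ring

/-- `gPrim` is even in `η`. -/
theorem gPrim_neg_eta (η w : ℝ) : gPrim (-η) w = gPrim η w := by
  simp only [gPrim, neg_sq, div_neg, Real.arctan_neg]
  ring

/-- `halfLog η w ≥ 0` as soon as `w² + η² ≥ 1`. -/
theorem halfLog_nonneg {w : ℝ} (h : 1 ≤ w ^ 2 + η ^ 2) : 0 ≤ halfLog η w :=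
  div_nonneg (Real.log_nonneg h) two_pos.le

/-- `halfLog η` is monotone on `[0, ∞)` (for `η ≠ 0`). -/
theorem halfLog_mono (hη : η ≠ 0) {a b : ℝ} (ha : 0 ≤ a) (hab : a ≤ b) :
    halfLog η a ≤ halfLog η b := by
  unfold halfLog
  have hpos : 0 < a ^ 2 + η ^ 2 := by positivity
  have hsq : a ^ 2 ≤ b ^ 2 := by nlinarith
  have := Real.log_le_log hpos (by linarith : a ^ 2 + η ^ 2 ≤ b ^ 2 + η ^ 2)
  linarith

/-- `d/dw gPrim η w = halfLog η w` for `η ≠ 0`. -/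
theorem hasDerivAt_gPrim (hη : η ≠ 0) (w : ℝ) : HasDerivAt (gPrim η) (halfLog η w) w := by
  have hpos : 0 < w ^ 2 + η ^ 2 := by positivity
  have h1 : HasDerivAt (fun w : ℝ => w ^ 2 + η ^ 2) (2 * w) w := by
    simpa using ((hasDerivAt_pow 2 w).add_const (η ^ 2))
  have h2 : HasDerivAt (fun w : ℝ => Real.log (w ^ 2 + η ^ 2)) (2 * w / (w ^ 2 + η ^ 2)) w :=
    h1.log hpos.ne'
  have h3 : HasDerivAt (fun w : ℝ => w / η) (1 / η) w := (hasDerivAt_id' w).div_const η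
  have h4 : HasDerivAt (fun w : ℝ => Real.arctan (w / η))
      (1 / (1 + (w / η) ^ 2) * (1 / η)) w := h3.arctan
  have h5 : HasDerivAt (fun w : ℝ => w * Real.log (w ^ 2 + η ^ 2) / 2 - w + η * Real.arctan (w / η))
      ((1 * Real.log (w ^ 2 + η ^ 2) + w * (2 * w / (w ^ 2 + η ^ 2))) / 2 - 1
        + η * (1 / (1 + (w / η) ^ 2) * (1 / η))) w :=
    ((((hasDerivAt_id' w).mul h2).div_const 2).sub (hasDerivAt_id' w)).add (h4.const_mul η)
  have e : (1 * Real.log (w ^ 2 + η ^ 2) + w * (2 * w / (w ^ 2 + η ^ 2))) / 2 - 1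
      + η * (1 / (1 + (w / η) ^ 2) * (1 / η)) = halfLog η w := by
    unfold halfLog
    field_simp
    ring
  rw [← e]
  exact h5

/-- `d/dη gPrim η w = arctan (w / η)` for `η ≠ 0`: the `η`-derivative of the primitive is the angle
subtended by `w`. -/
theorem hasDerivAt_gPrim_eta (hη : η ≠ 0) (w : ℝ) :
    HasDerivAt (fun η : ℝ => gPrim η w) (Real.arctan (w / η)) η := by
  have hpos : 0 < w ^ 2 + η ^ 2 := by positivity
  have h1 : HasDerivAt (fun η : ℝ => w ^ 2 + η ^ 2) (2 * η) η := by
    simpa using ((hasDerivAt_pow 2 η).const_add (w ^ 2))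
  have h2 : HasDerivAt (fun η : ℝ => Real.log (w ^ 2 + η ^ 2)) (2 * η / (w ^ 2 + η ^ 2)) η :=
    h1.log hpos.ne'
  have h3 : HasDerivAt (fun η : ℝ => w / η) ((0 * η - w * 1) / η ^ 2) η :=
    (hasDerivAt_const η w).div (hasDerivAt_id' η) hη
  have h4 : HasDerivAt (fun η : ℝ => Real.arctan (w / η))
      (1 / (1 + (w / η) ^ 2) * ((0 * η - w * 1) / η ^ 2)) η := h3.arctan
  have h5 : HasDerivAt (fun η : ℝ => w * Real.log (w ^ 2 + η ^ 2) / 2 - w + η * Real.arctan (w / η))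
      (w * (2 * η / (w ^ 2 + η ^ 2)) / 2 - 0
        + (1 * Real.arctan (w / η) + η * (1 / (1 + (w / η) ^ 2) * ((0 * η - w * 1) / η ^ 2)))) η :=
    (((h2.const_mul w).div_const 2).sub (hasDerivAt_const η w)).add ((hasDerivAt_id' η).mul h4)
  have e : w * (2 * η / (w ^ 2 + η ^ 2)) / 2 - 0
      + (1 * Real.arctan (w / η) + η * (1 / (1 + (w / η) ^ 2) * ((0 * η - w * 1) / η ^ 2)))
      = Real.arctan (w / η) := by
    field_simp
    ring
  rw [← e]
  exact h5

/-- `gPrim η` is continuous (for `η ≠ 0`). -/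
theorem continuous_gPrim (hη : η ≠ 0) : Continuous (gPrim η) :=
  continuous_iff_continuousAt.2 fun w => (hasDerivAt_gPrim hη w).continuousAt

/-! ## Mean-value comparisons -/

/-- Mean value theorem for `gPrim η` on `[a, b]`. -/
theorem exists_gPrim_sub_eq (hη : η ≠ 0) {a b : ℝ} (hab : a < b) :
    ∃ c ∈ Ioo a b, gPrim η b - gPrim η a = (b - a) * halfLog η c := by
  obtain ⟨c, hc, h⟩ := exists_hasDerivAt_eq_slope (gPrim η) (halfLog η) hab
    (continuous_gPrim hη).continuousOn (fun x _ => hasDerivAt_gPrim hη x)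
  refine ⟨c, hc, ?_⟩
  have hba : b - a ≠ 0 := sub_ne_zero.2 hab.ne'
  rw [h]
  field_simp

/-- On `[0, ∞)` (where `halfLog η` is monotone):
`(b − a) · halfLog η a ≤ gPrim η b − gPrim η a ≤ (b − a) · halfLog η b` for `0 ≤ a ≤ b`. -/
theorem gPrim_sub_bounds_of_nonneg (hη : η ≠ 0) {a b : ℝ} (ha : 0 ≤ a) (hab : a ≤ b) :
    (b - a) * halfLog η a ≤ gPrim η b - gPrim η a ∧
      gPrim η b - gPrim η a ≤ (b - a) * halfLog η b := by
  rcases hab.eq_or_lt with rfl | hlt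
  · simp
  obtain ⟨c, hc, h⟩ := exists_gPrim_sub_eq hη hlt
  rw [h]
  have hba : 0 ≤ b - a := sub_nonneg.2 hab
  exact ⟨mul_le_mul_of_nonneg_left (halfLog_mono hη ha hc.1.le) hba,
    mul_le_mul_of_nonneg_left (halfLog_mono hη (ha.trans hc.1.le) hc.2.le) hba⟩

/-- On `(−∞, 0]` (where `halfLog η` is antitone):
`(b − a) · halfLog η b ≤ gPrim η b − gPrim η a ≤ (b − a) · halfLog η a` for `a ≤ b ≤ 0`. -/
theorem gPrim_sub_bounds_of_nonpos (hη : η ≠ 0) {a b : ℝ} (hb : b ≤ 0) (hab : a ≤ b) :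
    (b - a) * halfLog η b ≤ gPrim η b - gPrim η a ∧
      gPrim η b - gPrim η a ≤ (b - a) * halfLog η a := by
  have h := gPrim_sub_bounds_of_nonneg hη (neg_nonneg.2 hb) (neg_le_neg hab)
  simp only [gPrim_neg, halfLog_neg] at h
  constructor <;> nlinarith [h.1, h.2]

/-- Upper sum bound on the increasing side: if all nodes `v + i` (`lo ≤ i < hi`) are `≥ 0` then
`∑ halfLog η (v + i) ≤ gPrim η (v + hi) − gPrim η (v + lo)`. -/
theorem sum_Ico_halfLog_le (hη : η ≠ 0) {v : ℝ} {lo hi : ℕ} (hv : 0 ≤ v + lo) (h : lo ≤ hi) :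
    ∑ i ∈ Finset.Ico lo hi, halfLog η (v + i) ≤ gPrim η (v + hi) - gPrim η (v + lo) := by
  induction hi, h using Nat.le_induction with
  | base => simp
  | succ k hk ih =>
    rw [Finset.sum_Ico_succ_top hk, Nat.cast_succ]
    have hk' : (lo : ℝ) ≤ k := by exact_mod_cast hk
    have hk0 : 0 ≤ v + k := by linarith
    have step := (gPrim_sub_bounds_of_nonneg hη hk0 (by linarith : v + k ≤ v + k + 1)).1
    rw [show v + (k : ℝ) + 1 - (v + k) = 1 by ring, one_mul] at step
    rw [show v + ((k : ℝ) + 1) = v + k + 1 by ring]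
    linarith

/-- Lower sum bound on the increasing side: if all nodes `v + i` (`lo ≤ i < hi`) are `≥ 1` then
`gPrim η (v + hi − 1) − gPrim η (v + lo − 1) ≤ ∑ halfLog η (v + i)`. -/
theorem le_sum_Ico_halfLog (hη : η ≠ 0) {v : ℝ} {lo hi : ℕ} (hv : 1 ≤ v + lo) (h : lo ≤ hi) :
    gPrim η (v + hi - 1) - gPrim η (v + lo - 1) ≤ ∑ i ∈ Finset.Ico lo hi, halfLog η (v + i) := by
  induction hi, h using Nat.le_induction with
  | base => simp
  | succ k hk ih =>
    rw [Finset.sum_Ico_succ_top hk, Nat.cast_succ]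
    have hk' : (lo : ℝ) ≤ k := by exact_mod_cast hk
    have hk0 : 0 ≤ v + k - 1 := by linarith
    have step := (gPrim_sub_bounds_of_nonneg hη hk0 (by linarith : v + k - 1 ≤ v + k)).2
    rw [show v + (k : ℝ) - (v + k - 1) = 1 by ring, one_mul] at step
    rw [show v + ((k : ℝ) + 1) - 1 = v + k by ring]
    linarith

/-- Upper sum bound on the decreasing side: if all nodes `v + i` (`lo ≤ i < hi`) are `≤ 0`
(i.e. `v + hi ≤ 1`) then `∑ halfLog η (v + i) ≤ gPrim η (v + hi − 1) − gPrim η (v + lo − 1)`. -/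
theorem sum_Ico_halfLog_le_of_nonpos (hη : η ≠ 0) {v : ℝ} {lo hi : ℕ} (h : lo ≤ hi)
    (hv : v + hi ≤ 1) :
    ∑ i ∈ Finset.Ico lo hi, halfLog η (v + i) ≤ gPrim η (v + hi - 1) - gPrim η (v + lo - 1) := by
  induction hi, h using Nat.le_induction with
  | base => simp
  | succ k hk ih =>
    rw [Finset.sum_Ico_succ_top hk, Nat.cast_succ]
    push_cast at hv
    have hk0 : v + k ≤ 0 := by linarith
    have step := (gPrim_sub_bounds_of_nonpos hη hk0 (by linarith : v + k - 1 ≤ v + k)).1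
    rw [show v + (k : ℝ) - (v + k - 1) = 1 by ring, one_mul] at step
    rw [show v + ((k : ℝ) + 1) - 1 = v + k by ring]
    linarith [ih (by linarith)]

/-- The middle piece removed in the straddling case: `gPrim η (1/2) − gPrim η (−1/2) ≥ −(1 + log 2)`
(from `log (1/4 + η²) ≥ log (1/4)` and `η · arctan (1/(2η)) ≥ 0`). -/
theorem gPrim_half_sub_ge (η : ℝ) : -(1 + Real.log 2) ≤ gPrim η (1 / 2) - gPrim η (-(1 / 2)) := by
  rw [gPrim_neg]
  have hlog : Real.log (1 / 4) ≤ Real.log ((1 / 2 : ℝ) ^ 2 + η ^ 2) :=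
    Real.log_le_log (by norm_num) (by nlinarith [sq_nonneg η])
  have hl4 : Real.log (1 / 4 : ℝ) = -(2 * Real.log 2) := by
    rw [show (1 / 4 : ℝ) = (2 ^ 2)⁻¹ by norm_num, Real.log_inv, Real.log_pow]
    push_cast
    ring
  have hat : 0 ≤ η * Real.arctan (1 / 2 / η) := by
    rcases le_total 0 η with h | h
    · refine mul_nonneg h ?_
      have := Real.arctan_strictMono.monotone (div_nonneg (by norm_num : (0 : ℝ) ≤ 1 / 2) h)
      rwa [Real.arctan_zero] at this
    · have hx : 1 / 2 / η ≤ 0 := div_nonpos_of_nonneg_of_nonpos (by norm_num) h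
      have := Real.arctan_strictMono.monotone hx
      rw [Real.arctan_zero] at this
      nlinarith [mul_nonneg (neg_nonneg.2 h) (neg_nonneg.2 this)]
  unfold gPrim
  nlinarith [hlog, hl4, hat]

/-- Straddling block with half-integer nodes `i − N + 1/2` (`lo ≤ i < hi`, `lo ≤ N ≤ hi`):
`∑ halfLog η (i − N + 1/2) ≤ gPrim η (hi − N + 1/2) − gPrim η (lo − N − 1/2) + (1 + log 2)`. -/
theorem sum_Ico_halfLog_le_straddle (hη : η ≠ 0) {N lo hi : ℕ} (hlo : lo ≤ N) (hhi : N ≤ hi) :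
    ∑ i ∈ Finset.Ico lo hi, halfLog η ((i : ℝ) - N + 1 / 2) ≤
      gPrim η ((hi : ℝ) - N + 1 / 2) - gPrim η ((lo : ℝ) - N - 1 / 2) + (1 + Real.log 2) := by
  rw [← Finset.sum_Ico_consecutive _ hlo hhi]
  have e : ∀ i : ℕ, (-(N : ℝ) + 1 / 2 + i) = (i : ℝ) - N + 1 / 2 := fun i => by ring
  have h1 := sum_Ico_halfLog_le_of_nonpos hη (v := -(N : ℝ) + 1 / 2) hlo (by norm_num)
  have h2 := sum_Ico_halfLog_le hη (v := -(N : ℝ) + 1 / 2) (lo := N) (hi := hi) (by norm_num) hhi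
  have h3 := gPrim_half_sub_ge η
  simp only [e] at h1 h2
  have e1 : gPrim η ((N : ℝ) - N + 1 / 2 - 1) = gPrim η (-(1 / 2)) := by
    congr 1
    ring
  have e2 : gPrim η ((lo : ℝ) - N + 1 / 2 - 1) = gPrim η ((lo : ℝ) - N - 1 / 2) := by
    congr 1
    ring
  have e3 : gPrim η ((N : ℝ) - N + 1 / 2) = gPrim η (1 / 2) := by
    congr 1
    ring
  linarith

/-- Scaling law: `gPrim (c η) (c w) = c · (gPrim η w + w · log c)` for `c > 0`, `η ≠ 0`. -/
theorem gPrim_scale (hη : η ≠ 0) {c : ℝ} (hc : 0 < c) (w : ℝ) :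
    gPrim (c * η) (c * w) = c * (gPrim η w + w * Real.log c) := by
  have hpos : 0 < w ^ 2 + η ^ 2 := by positivity
  have e1 : (c * w) ^ 2 + (c * η) ^ 2 = c ^ 2 * (w ^ 2 + η ^ 2) := by ring
  have e2 : Real.log ((c * w) ^ 2 + (c * η) ^ 2) = 2 * Real.log c + Real.log (w ^ 2 + η ^ 2) := by
    rw [e1, Real.log_mul (by positivity) hpos.ne', Real.log_pow]
    push_cast
    ring
  have e3 : c * w / (c * η) = w / η := mul_div_mul_left w η hc.ne'
  simp only [gPrim, e2, e3]
  ring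

/-! ## The line profile -/

/-- The factorial constant `11 log 11 − 13 log 13 − 9 log 9 − 5 log 5 + 16` of the P15 profile. -/
def profileConst : ℝ :=
  11 * Real.log 11 - 13 * Real.log 13 - 9 * Real.log 9 - 5 * Real.log 5 + 16

/-- `profile0 ξ η`: the `2π|η|`-free part of the P15 line profile at abscissa `ξ` — three numerator
blocks `(ξ+2 | ξ−11)`, `(ξ | ξ−9)`, `(ξ−2 | ξ−7)`, the denominator block `(ξ+15 | ξ+4)`, and
`profileConst`. -/
def profile0 (ξ η : ℝ) : ℝ :=
  (gPrim η (ξ + 2) - gPrim η (ξ - 11)) + (gPrim η ξ - gPrim η (ξ - 9))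
    + (gPrim η (ξ - 2) - gPrim η (ξ - 7)) - (gPrim η (ξ + 15) - gPrim η (ξ + 4)) + profileConst

/-- The P15 line profile `profile ξ η = profile0 ξ η − 2π|η|` (cell record `P15KERNEL.md` §6:
the scaled logarithm of `|R_n(t)| · e^{−2π|Im t|}` along `Re t = ξ n − (11n+1)`). -/
def profile (ξ η : ℝ) : ℝ := profile0 ξ η - 2 * Real.pi * |η|

/-- `angle ξ η`: the `η`-derivative of `profile0 ξ`, a signed sum of eight angles `arctan (w/η)`. -/
def angle (ξ η : ℝ) : ℝ :=
  (Real.arctan ((ξ + 2) / η) - Real.arctan ((ξ - 11) / η))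
    + (Real.arctan (ξ / η) - Real.arctan ((ξ - 9) / η))
    + (Real.arctan ((ξ - 2) / η) - Real.arctan ((ξ - 7) / η))
    - (Real.arctan ((ξ + 15) / η) - Real.arctan ((ξ + 4) / η))

/-- `profile0` is even in `η`. -/
theorem profile0_neg_eta (ξ η : ℝ) : profile0 ξ (-η) = profile0 ξ η := by
  simp only [profile0, gPrim_neg_eta]

/-- `profile` is even in `η`. -/
theorem profile_neg_eta (ξ η : ℝ) : profile ξ (-η) = profile ξ η := by
  simp only [profile, profile0_neg_eta, abs_neg]

/-- `d/dη profile0 ξ η = angle ξ η` for `η ≠ 0`. -/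
theorem hasDerivAt_profile0_eta (ξ : ℝ) (hη : η ≠ 0) :
    HasDerivAt (fun η : ℝ => profile0 ξ η) (angle ξ η) η := by
  have h := fun w => hasDerivAt_gPrim_eta hη w
  have key := (((((h (ξ + 2)).sub (h (ξ - 11))).add ((h ξ).sub (h (ξ - 9)))).add
    ((h (ξ - 2)).sub (h (ξ - 7)))).sub ((h (ξ + 15)).sub (h (ξ + 4)))).add_const profileConst
  exact key

/-- `d/dη profile ξ η = angle ξ η − 2π` for `η > 0`. -/
theorem hasDerivAt_profile_eta (ξ : ℝ) (hη : 0 < η) :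
    HasDerivAt (fun η : ℝ => profile ξ η) (angle ξ η - 2 * Real.pi) η := by
  have habs : HasDerivAt (fun η : ℝ => 2 * Real.pi * |η|) (2 * Real.pi * 1) η := by
    refine ((hasDerivAt_id' η).congr_of_eventuallyEq ?_).const_mul (2 * Real.pi)
    filter_upwards [Ioi_mem_nhds hη] with x hx using abs_of_pos hx
  have key : HasDerivAt (fun η : ℝ => profile0 ξ η - 2 * Real.pi * |η|)
      (angle ξ η - 2 * Real.pi * 1) η := (hasDerivAt_profile0_eta ξ hη.ne').sub habs
  rw [mul_one] at key
  exact key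

/-- `profile ξ` is continuous on `(0, ∞)`. -/
theorem continuousOn_profile (ξ : ℝ) : ContinuousOn (fun η : ℝ => profile ξ η) (Ioi 0) :=
  fun _ hη => (hasDerivAt_profile_eta ξ hη).continuousAt.continuousWithinAt

end Summit.KontsevichZagierPeriods.Zeta5Search.Denom.LineProfile

end
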